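import Mathlib
import Summits.ResolutionOfSingularities.ResolutionOfSingularities.Theorems.HomologicalConductorPersistenceSurfaceHullCover
import HarnessLib

/-!
# Crux `PersistenceSurface` (stmt-ResolutionOfSingularities-19970) · S-2 algebraic assembly — FINITE SPECIAL COVERS
# (res-L1-w44b-plan-1's CRUX-PLAN v7 §3 «finite special cover ⇒ hcover», ORDER w44b-o4)

Route `ResolutionOfSingularities/HomologicalConductor`, chain W4.4b (cell res-hironaka; seat res-type-028 on
res-L1-w44b-plan-1's ORDER w44b-o4). OURS; nothing here is a statement of the manuscript under review (Hironaka 2017);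
AI-written, weaker than expert review. Sequel to `…Theorems.HomologicalConductorPersistenceSurfaceHullCover` (p501682,
HC-R/HC-3/HC-1/HC-2/HC-0 + the free-form bridge): the cover hypothesis `hcover` of HC-1/HC-2 is now allowed to be a
FINITE PRODUCT of a free module and powers of the reflexive hulls `(T' ⊗_T Y_j)**` of finitely many `x`-stably-annihilated
`T`-modules `Y_j` — the shape M-rat v2 steps (3)–(4) deliver at a rational step (`ι` = the curves over the centre, `Y_l` =
the special `M_l`, multiplicities `a`, `b_l` from the KRS decomposition, `(T' ⊗ M_l)**` = the special of `T'` by (E-sur);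
all of that geometry stays packed in the hypothesis).

* **FC-1** `StablyAnnihilates.of_projective` — a finitely generated projective `P` is stably annihilated by EVERY `x`
  (`x • 𝟙 P` factors through `P` itself); corollaries `StablyAnnihilates.of_free`, `StablyAnnihilates.fin`
  (`ModuleCat.of T (Fin a → T)`).
* **FC-2** closure under finite products: `StablyAnnihilates.of_linearEquiv`, `.prod` (`M × N`), `.pi_fin` (`Π i : Fin n`),
  `.pi` (`Π j : ι`, `[Fintype ι]`, `ι : Type`), `.pow` (`Fin b → M`) — products of the projective middles.
* **FC-3** `map_mem_cohomologyAnnihilatorOfDegree_succ_of_finiteHullCover` — THE TARGET: if every `m`-th syzygy over `T'`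
  is a linear retract of `(Fin a → T') × Π j, (Fin (b j) → (T' ⊗_T Y j)**)` for `x`-stably-annihilated `Y j`
  (`j : ι`, `ι` finite), then `algebraMap T T' x ∈ caᵐ⁺¹(T')` (FC-1 + `StablyAnnihilates.dual_dual_baseChange` + FC-2 +
  `StablyAnnihilates.of_retract_linearMap` + CA1 backward, exactly as HC-1; exponent one).
* **FC-4** the single-dual sibling `…_of_finiteDualCover` (`(T' ⊗_T Y j)*` factors) and the plain sibling
  `…_of_finiteCover` (`T' ⊗_T Y j` factors).

References: S. B. Iyengar, R. Takahashi, *Annihilation of cohomology and strong generation of module categories*,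
IMRN 2016, arXiv:1404.1476, §2 (Remark 2.13) [`IyengarTakahashi2014`].
-/

-- single-problem summit: the doubled namespace component `ResolutionOfSingularities` is forced
set_option linter.dupNamespace false

noncomputable section

open CategoryTheory Literature.RingTheory.CohomologyAnnihilator
open Summit.ResolutionOfSingularities.ResolutionOfSingularities.Theorems.NoZeno.SandwichCluster
open Summit.ResolutionOfSingularities.ResolutionOfSingularities.Theorems.HomologicalConductor.PersistenceSurfaceHullCover
open scoped TensorProduct

universe u

namespace Summit.ResolutionOfSingularities.ResolutionOfSingularities.Theorems.HomologicalConductor.PersistenceSurfaceFiniteCover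

/-! ## FC-1: projectives (and free modules) are stably annihilated by everything -/

/-- **FC-1 · a finitely generated projective `P` is stably annihilated by EVERY `x`**: `x • 𝟙 P` factors through `P`
itself (`ι = x • 𝟙 P`, `π = 𝟙 P`). [folklore] -/
theorem StablyAnnihilates.of_projective {T : Type u} [CommRing T] (x : T) (P : ModuleCat.{u} T) [Module.Finite T P]
    [Module.Projective T P] : StablyAnnihilates T x P :=
  ⟨P, inferInstance, (IsProjective.iff_projective (R := T) P).mp inferInstance, x • 𝟙 P, 𝟙 P, by
    rw [Category.comp_id]⟩

/-- FC-1, instance-free type form: a finitely generated free (hence projective) `T`-module `M` is stably annihilated by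
every `x`. [folklore] -/
theorem StablyAnnihilates.of_free {T : Type u} [CommRing T] (x : T) (M : Type u) [AddCommGroup M] [Module T M]
    [Module.Finite T M] [Module.Free T M] : StablyAnnihilates T x (ModuleCat.of T M) :=
  StablyAnnihilates.of_projective x (ModuleCat.of T M)

/-- FC-1 for the finite free module `Fin a → T`. [folklore] -/
theorem StablyAnnihilates.fin {T : Type u} [CommRing T] (x : T) (a : ℕ) :
    StablyAnnihilates T x (ModuleCat.of T (Fin a → T)) :=
  StablyAnnihilates.of_free x (Fin a → T)

/-! ## FC-2: closure under linear equivalences and finite products -/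

/-- Stable annihilation transports along linear equivalences of the underlying modules (`StablyAnnihilates.of_iso` on
`LinearEquiv.toModuleIso`). [folklore] -/
theorem StablyAnnihilates.of_linearEquiv {T : Type u} [CommRing T] {x : T} {M N : Type u} [AddCommGroup M]
    [Module T M] [AddCommGroup N] [Module T N] (h : StablyAnnihilates T x (ModuleCat.of T M)) (e : M ≃ₗ[T] N) :
    StablyAnnihilates T x (ModuleCat.of T N) :=
  h.of_iso e.toModuleIso

/-- **FC-2 · binary products**: if `x • 𝟙` factors through finitely generated projectives `P₁`, `P₂` on `M`, `N`, then it
factors through `P₁ × P₂` on `M × N` (`LinearMap.prodMap` of the two factorisations). [folklore] -/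
theorem StablyAnnihilates.prod {T : Type u} [CommRing T] {x : T} {M N : Type u} [AddCommGroup M] [Module T M]
    [AddCommGroup N] [Module T N] (hM : StablyAnnihilates T x (ModuleCat.of T M))
    (hN : StablyAnnihilates T x (ModuleCat.of T N)) : StablyAnnihilates T x (ModuleCat.of T (M × N)) := by
  obtain ⟨P₁, hP₁fin, hP₁, ι₁, π₁, h₁⟩ := hM
  obtain ⟨P₂, hP₂fin, hP₂, ι₂, π₂, h₂⟩ := hN
  haveI := hP₁fin; haveI := hP₂fin; haveI := hP₁; haveI := hP₂
  haveI : Module.Projective T P₁ := P₁.projective_of_module_projective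
  haveI : Module.Projective T P₂ := P₂.projective_of_module_projective
  refine ⟨ModuleCat.of T (P₁ × P₂), inferInstance,
    (IsProjective.iff_projective (R := T) (P₁ × P₂)).mp inferInstance,
    ModuleCat.ofHom (ι₁.hom.prodMap ι₂.hom), ModuleCat.ofHom (π₁.hom.prodMap π₂.hom), ?_⟩
  refine ModuleCat.hom_ext (LinearMap.ext fun mn => ?_)
  obtain ⟨m, n⟩ := mn
  have hm := apply_apply_eq_smul_of_comp_eq_smul_id h₁ m
  have hn := apply_apply_eq_smul_of_comp_eq_smul_id h₂ n
  simp [hm, hn]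

/-- FC-2 · finite products indexed by `Fin n` (induction on `n` via `Fin.consLinearEquiv`; the empty product is the
zero module, stably annihilated through `Fin 0 → T`). [folklore] -/
theorem StablyAnnihilates.pi_fin {T : Type u} [CommRing T] {x : T} :
    ∀ {n : ℕ} (M : Fin n → Type u) [∀ i, AddCommGroup (M i)] [∀ i, Module T (M i)],
      (∀ i, StablyAnnihilates T x (ModuleCat.of T (M i))) → StablyAnnihilates T x (ModuleCat.of T (Π i, M i))
  | 0, M, _, _, _ => by
    refine stablyAnnihilates_of_linearMap (s := 0) (0 : (Π i, M i) →ₗ[T] (Fin 0 → T)) 0 ?_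
    exact LinearMap.ext fun f => funext fun i => Fin.elim0 i
  | n + 1, M, _, _, h => by
    have htail := StablyAnnihilates.pi_fin (fun i : Fin n => M i.succ) fun i => h i.succ
    have hprod := StablyAnnihilates.prod (h 0) htail
    exact StablyAnnihilates.of_linearEquiv hprod (Fin.consLinearEquiv T M)

/-- **FC-2 · finite products** `Π j : ι, M j` over a finite index type `ι : Type` (transport of `pi_fin` along
`LinearEquiv.piCongrLeft` for `Fintype.equivFin ι`). [folklore] -/
theorem StablyAnnihilates.pi {T : Type u} [CommRing T] {x : T} {ι : Type} [Fintype ι] (M : ι → Type u)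
    [∀ j, AddCommGroup (M j)] [∀ j, Module T (M j)] (h : ∀ j, StablyAnnihilates T x (ModuleCat.of T (M j))) :
    StablyAnnihilates T x (ModuleCat.of T (Π j, M j)) := by
  classical
  let e : ι ≃ Fin (Fintype.card ι) := Fintype.equivFin ι
  have hfin := StablyAnnihilates.pi_fin (fun i : Fin (Fintype.card ι) => M (e.symm i)) fun i => h (e.symm i)
  exact StablyAnnihilates.of_linearEquiv hfin (LinearEquiv.piCongrLeft T M e.symm)

/-- FC-2 · finite powers `Fin b → M`. [folklore] -/
theorem StablyAnnihilates.pow {T : Type u} [CommRing T] {x : T} {M : Type u} [AddCommGroup M] [Module T M]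
    (h : StablyAnnihilates T x (ModuleCat.of T M)) (b : ℕ) : StablyAnnihilates T x (ModuleCat.of T (Fin b → M)) :=
  StablyAnnihilates.pi (fun _ : Fin b => M) fun _ => h

/-! ## FC-3 / FC-4: persistence from a FINITE hull / dual / plain base-change cover -/

/-- The covering product of FC-3 is stably annihilated by `algebraMap T T' x`: free part by FC-1, each power of a
reflexive hull `(T' ⊗_T Y j)**` by `StablyAnnihilates.dual_dual_baseChange` (p501682) and FC-2. [folklore] -/
theorem stablyAnnihilates_finiteHullProduct {T T' : Type u} [CommRing T] [CommRing T'] [Algebra T T'] (x : T)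
    {ι : Type} [Fintype ι] (Y : ι → ModuleCat.{u} T) (hY : ∀ j, StablyAnnihilates T x (Y j)) (a : ℕ) (b : ι → ℕ) :
    StablyAnnihilates T' (algebraMap T T' x) (ModuleCat.of T'
      ((Fin a → T') × (Π j, Fin (b j) → Module.Dual T' (Module.Dual T' (T' ⊗[T] Y j))))) :=
  StablyAnnihilates.prod (StablyAnnihilates.fin _ a)
    (StablyAnnihilates.pi (fun j => Fin (b j) → Module.Dual T' (Module.Dual T' (T' ⊗[T] Y j)))
      fun j => StablyAnnihilates.pow (StablyAnnihilates.dual_dual_baseChange (hY j)) (b j))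

/-- The same for the single duals `(T' ⊗_T Y j)*`. [folklore] -/
theorem stablyAnnihilates_finiteDualProduct {T T' : Type u} [CommRing T] [CommRing T'] [Algebra T T'] (x : T)
    {ι : Type} [Fintype ι] (Y : ι → ModuleCat.{u} T) (hY : ∀ j, StablyAnnihilates T x (Y j)) (a : ℕ) (b : ι → ℕ) :
    StablyAnnihilates T' (algebraMap T T' x) (ModuleCat.of T'
      ((Fin a → T') × (Π j, Fin (b j) → Module.Dual T' (T' ⊗[T] Y j)))) :=
  StablyAnnihilates.prod (StablyAnnihilates.fin _ a)
    (StablyAnnihilates.pi (fun j => Fin (b j) → Module.Dual T' (T' ⊗[T] Y j))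
      fun j => StablyAnnihilates.pow (StablyAnnihilates.dual_baseChange (hY j)) (b j))

/-- The same for the plain base changes `T' ⊗_T Y j`. [folklore] -/
theorem stablyAnnihilates_finiteProduct {T T' : Type u} [CommRing T] [CommRing T'] [Algebra T T'] (x : T)
    {ι : Type} [Fintype ι] (Y : ι → ModuleCat.{u} T) (hY : ∀ j, StablyAnnihilates T x (Y j)) (a : ℕ) (b : ι → ℕ) :
    StablyAnnihilates T' (algebraMap T T' x) (ModuleCat.of T' ((Fin a → T') × (Π j, Fin (b j) → T' ⊗[T] Y j))) :=
  StablyAnnihilates.prod (StablyAnnihilates.fin _ a)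
    (StablyAnnihilates.pi (fun j => Fin (b j) → T' ⊗[T] Y j)
      fun j => StablyAnnihilates.pow (StablyAnnihilates.baseChange (hY j)) (b j))

/-- **FC-3 · THE TARGET — level-`(m+1)` persistence from a FINITE HULL COVER**: `x`-stably-annihilated `T`-modules
`Y j` (`j : ι`, `ι` finite); if every `m`-th syzygy `L` of a finitely generated `T'`-module is a linear retract of
`(Fin a → T') × Π j, (Fin (b j) → (T' ⊗_T Y j)**)` for some multiplicities `a`, `b`, then
`algebraMap T T' x ∈ caᵐ⁺¹(T')`. Proof: the product is stably annihilated (`stablyAnnihilates_finiteHullProduct`), retracts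
inherit (`StablyAnnihilates.of_retract_linearMap`, p501682), CA1 backward over `T'` — exponent one, as in HC-1.
[cite: IyengarTakahashi2014, Remark 2.13] -/
theorem map_mem_cohomologyAnnihilatorOfDegree_succ_of_finiteHullCover
    {T T' : Type u} [CommRing T] [CommRing T'] [IsNoetherianRing T'] [Algebra T T'] (x : T) (m : ℕ)
    {ι : Type} [Fintype ι] (Y : ι → ModuleCat.{u} T) (hY : ∀ j, StablyAnnihilates T x (Y j))
    (hcover : ∀ (M L : ModuleCat.{u} T'), Module.Finite T' M → IsSyzygy m M L →
      ∃ (a : ℕ) (b : ι → ℕ)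
        (i : L →ₗ[T'] ((Fin a → T') × (Π j, Fin (b j) → Module.Dual T' (Module.Dual T' (T' ⊗[T] Y j)))))
        (r : ((Fin a → T') × (Π j, Fin (b j) → Module.Dual T' (Module.Dual T' (T' ⊗[T] Y j)))) →ₗ[T'] L),
        r ∘ₗ i = LinearMap.id) :
    algebraMap T T' x ∈ cohomologyAnnihilatorOfDegree T' (m + 1) := by
  refine (mem_cohomologyAnnihilatorOfDegree_succ_iff_forall_isSyzygy _).mpr fun M L hM hL => ?_
  obtain ⟨a, b, i, r, hri⟩ := hcover M L hM hL
  exact StablyAnnihilates.of_retract_linearMap (stablyAnnihilates_finiteHullProduct x Y hY a b) i r hri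

/-- **FC-4 · the single-dual sibling**: the same with the factors `(T' ⊗_T Y j)*`. [cite: IyengarTakahashi2014, Remark 2.13] -/
theorem map_mem_cohomologyAnnihilatorOfDegree_succ_of_finiteDualCover
    {T T' : Type u} [CommRing T] [CommRing T'] [IsNoetherianRing T'] [Algebra T T'] (x : T) (m : ℕ)
    {ι : Type} [Fintype ι] (Y : ι → ModuleCat.{u} T) (hY : ∀ j, StablyAnnihilates T x (Y j))
    (hcover : ∀ (M L : ModuleCat.{u} T'), Module.Finite T' M → IsSyzygy m M L →
      ∃ (a : ℕ) (b : ι → ℕ)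
        (i : L →ₗ[T'] ((Fin a → T') × (Π j, Fin (b j) → Module.Dual T' (T' ⊗[T] Y j))))
        (r : ((Fin a → T') × (Π j, Fin (b j) → Module.Dual T' (T' ⊗[T] Y j))) →ₗ[T'] L),
        r ∘ₗ i = LinearMap.id) :
    algebraMap T T' x ∈ cohomologyAnnihilatorOfDegree T' (m + 1) := by
  refine (mem_cohomologyAnnihilatorOfDegree_succ_iff_forall_isSyzygy _).mpr fun M L hM hL => ?_
  obtain ⟨a, b, i, r, hri⟩ := hcover M L hM hL
  exact StablyAnnihilates.of_retract_linearMap (stablyAnnihilates_finiteDualProduct x Y hY a b) i r hri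

/-- **FC-4 · the plain sibling**: the same with the factors `T' ⊗_T Y j`. [cite: IyengarTakahashi2014, Remark 2.13] -/
theorem map_mem_cohomologyAnnihilatorOfDegree_succ_of_finiteCover
    {T T' : Type u} [CommRing T] [CommRing T'] [IsNoetherianRing T'] [Algebra T T'] (x : T) (m : ℕ)
    {ι : Type} [Fintype ι] (Y : ι → ModuleCat.{u} T) (hY : ∀ j, StablyAnnihilates T x (Y j))
    (hcover : ∀ (M L : ModuleCat.{u} T'), Module.Finite T' M → IsSyzygy m M L →
      ∃ (a : ℕ) (b : ι → ℕ)
        (i : L →ₗ[T'] ((Fin a → T') × (Π j, Fin (b j) → T' ⊗[T] Y j)))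
        (r : ((Fin a → T') × (Π j, Fin (b j) → T' ⊗[T] Y j)) →ₗ[T'] L),
        r ∘ₗ i = LinearMap.id) :
    algebraMap T T' x ∈ cohomologyAnnihilatorOfDegree T' (m + 1) := by
  refine (mem_cohomologyAnnihilatorOfDegree_succ_iff_forall_isSyzygy _).mpr fun M L hM hL => ?_
  obtain ⟨a, b, i, r, hri⟩ := hcover M L hM hL
  exact StablyAnnihilates.of_retract_linearMap (stablyAnnihilates_finiteProduct x Y hY a b) i r hri

end Summit.ResolutionOfSingularities.ResolutionOfSingularities.Theorems.HomologicalConductor.PersistenceSurfaceFiniteCover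

end
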